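import Mathlib.Tactic.DeriveFintype
import Mathlib.Algebra.Polynomial.Inductions
import Literature.Computability.Complexity.NondeterministicProofs
import Literature.Computability.Complexity.TimeBoundsProofs
import HarnessLib

/-!
# Unary arithmetic machines: computing `p(|x|)` in unary in polynomial time

Machine-level infrastructure for the certificate calculus of `NP` (witness-length bounds
`|y| ≤ p(|x|)`, Arora–Barak 2009, Def. 2.1). Every use of such a bound inside a polynomial-time
machine (the NP normal form behind Cook–Reckhow's Prop. 1.4 (←) and behind the closure of `NP`
under Karp reductions) needs the value `p(|x|)` available *in unary on a work tape*. This file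
provides it, in the form of string functions in `FP` over the **unary header format**

  `hdr n a z = 1ⁿ 0 1ᵃ 0 z`     (`n`, `a` in unary, terminated by `0`, followed by a payload `z`),

parsed totally by `splitOnes` (count the leading `1`s, drop them and the following symbol):

* `initFn z = hdr |x| 0 z` where `x = (boolUnpair z).1` (`InitTM`, linear time);
* `succFn (hdr n a z) = hdr n (a + 1) z` (`SuccTM`, linear time);
* `mulFn (hdr n a z) = hdr n (a · n) z` (`MulTM`, quadratic time);
* by Horner's rule (`Polynomial.recOnHorner`) and closure of `FP` under composition
  (`PolyTimeComputable.comp_holds`), for every `p : Polynomial ℕ` the function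
  `evalHdrFn p z = hdr |x| (p |x|) z` is in `FP` (`evalHdrFn_mem_FP`).

All machines are standalone `Turing.FinTM2`s over the alphabet `Bool` (no simulation of other
machines); the end of the input is treated like the block terminator `0`, which is what makes
the specifications total. The proofs follow the template of `RePairTM` / `PairFstTM`.

## References

* S. Arora, B. Barak, *Computational Complexity: A Modern Approach*, CUP 2009, §1.3
  (multi-tape machines; "the reader … should convince themselves that basic arithmetic can be
  done in polynomial time"), Example 1.1/Claim 1.6 spirit, Def. 2.1 (the bound `p(|x|)`),
  §3.1 (time-constructible functions: "all polynomials are time constructible").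
* J. Hartmanis, R. E. Stearns, *On the computational complexity of algorithms*,
  Trans. AMS 117 (1965) (unary counting on multitape machines).
-/

namespace Literature.Computability.Complexity

open _root_.Computability

/-! ### The unary header format -/

/-- `ones n = 1ⁿ`. [folklore] -/
abbrev ones (n : ℕ) : List Bool := List.replicate n true

/-- The unary header format `hdr n a z = 1ⁿ 0 1ᵃ 0 z`. [Arora–Barak 2009, §1.3 (unary
counters on work tapes)] [cite: AroraBarakCC2009, §1.3] -/
def hdr (n a : ℕ) (z : List Bool) : List Bool :=
  ones n ++ false :: (ones a ++ false :: z)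

/-- Total parser of one unary block: the number of leading `1`s and the string after them and
after the following symbol (the terminator `0`, if present). [folklore] -/
def splitOnes : List Bool → ℕ × List Bool
  | true :: u => ((splitOnes u).1 + 1, (splitOnes u).2)
  | false :: u => (0, u)
  | [] => (0, [])

/-- `splitOnes` on a terminated block. [folklore] -/
@[simp] theorem splitOnes_ones_append (n : ℕ) (r : List Bool) :
    splitOnes (ones n ++ false :: r) = (n, r) := by
  induction n with
  | zero => rfl
  | succ n ih => simp [ones, List.replicate_succ, splitOnes, ih]

/-- `splitOnes` on an unterminated block. [folklore] -/
@[simp] theorem splitOnes_ones (n : ℕ) : splitOnes (ones n) = (n, []) := by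
  induction n with
  | zero => rfl
  | succ n ih => simp [ones, List.replicate_succ, splitOnes, ih]

/-- Size accounting for `splitOnes`: `k + |rest| ≤ |u|`. [folklore] -/
theorem splitOnes_le : ∀ u : List Bool, (splitOnes u).1 + (splitOnes u).2.length ≤ u.length
  | [] => by simp [splitOnes]
  | true :: u => by have := splitOnes_le u; simp [splitOnes]; omega
  | false :: u => by simp [splitOnes]

/-- Length of a header. [folklore] -/
@[simp] theorem length_hdr (n a : ℕ) (z : List Bool) :
    (hdr n a z).length = n + a + z.length + 2 := by
  simp [hdr]; omega

/-- `1ʲ ++ 1 :: l = 1 :: (1ʲ ++ l)` (moving a `1` across a block of `1`s). [folklore] -/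
@[simp] theorem replicate_append_true_cons (j : ℕ) (l : List Bool) :
    List.replicate j true ++ true :: l = true :: (List.replicate j true ++ l) := by
  induction j with
  | zero => rfl
  | succ j ih => simp [List.replicate_succ, ih]

/-- The successor on headers, as a total string function: insert a `1` after the first block
terminator. [folklore] -/
def succFn (u : List Bool) : List Bool :=
  ones (splitOnes u).1 ++ false :: true :: (splitOnes u).2

/-- `succFn (hdr n a z) = hdr n (a + 1) z`. [folklore] -/
@[simp] theorem succFn_hdr (n a : ℕ) (z : List Bool) : succFn (hdr n a z) = hdr n (a + 1) z := by
  simp [succFn, hdr, ones, List.replicate_succ]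

/-- Iterated successor: `succFn^[b] (hdr n a z) = hdr n (a + b) z`. [folklore] -/
theorem iterate_succFn_hdr (b n a : ℕ) (z : List Bool) :
    succFn^[b] (hdr n a z) = hdr n (a + b) z := by
  induction b generalizing a with
  | zero => rfl
  | succ b ih => rw [Function.iterate_succ_apply, succFn_hdr, ih]; ring_nf

/-- Multiplication of the accumulator by the first block, as a total string function.
[folklore] -/
def mulFn (u : List Bool) : List Bool :=
  hdr (splitOnes u).1 ((splitOnes (splitOnes u).2).1 * (splitOnes u).1)
    (splitOnes (splitOnes u).2).2

/-- `mulFn (hdr n a z) = hdr n (a * n) z`. [folklore] -/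
@[simp] theorem mulFn_hdr (n a : ℕ) (z : List Bool) : mulFn (hdr n a z) = hdr n (a * n) z := by
  simp [mulFn, hdr]

/-- Initial header of a pair-coded string: `initFn z = hdr |x| 0 z`, `x = (boolUnpair z).1`.
[Arora–Barak 2009, Def. 2.1 (the bound is a function of `|x|`)] [cite: AroraBarakCC2009, Def. 2.1] -/
def initFn (z : List Bool) : List Bool :=
  hdr (boolUnpair z).1.length 0 z

/-- Header carrying `p(|x|)` in unary: `evalHdrFn p z = hdr |x| (p |x|) z`.
[Arora–Barak 2009, Def. 2.1, §3.1] [cite: AroraBarakCC2009, §3.1] -/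
noncomputable def evalHdrFn (p : Polynomial ℕ) (z : List Bool) : List Bool :=
  hdr (boolUnpair z).1.length (p.eval (boolUnpair z).1.length) z

/-! ### Common machine scaffolding -/

/-- Phase labels shared by the unary machines (each machine uses a subset). [folklore] -/
inductive ULabel
  | read
  | outer
  | inner
  | back
  | copy
  | emit
  | emitA
  | emitN
  deriving DecidableEq, Fintype

/-! ### The successor machine -/

namespace SuccTM

open Turing StateTransition TM2Comp

/-- Stacks of the successor machine. [folklore] -/
inductive Stk
  | inp
  | aux
  | out
  deriving DecidableEq, Fintype

/-- Reset the register. [folklore] -/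
def clear : Option Bool → Option Bool := fun _ => none

/-- Program: `read` moves leading `1`s to `aux`; at the terminator (or end of input) it pushes
`0, 1`; `copy` moves the rest to `aux`; `emit` reverses `aux` onto the output. [folklore] -/
def prog : ULabel → TM2.Stmt (fun _ : Stk => Bool) ULabel (Option Bool)
  | .read =>
    TM2.Stmt.pop Stk.inp (fun _ a => a) <|
      TM2.Stmt.branch (fun v => decide (v = some true))
        (TM2.Stmt.push Stk.aux (fun _ => true) <| TM2.Stmt.load clear <|
          TM2.Stmt.goto fun _ => ULabel.read)
        (TM2.Stmt.push Stk.aux (fun _ => false) <| TM2.Stmt.push Stk.aux (fun _ => true) <|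
          TM2.Stmt.load clear <| TM2.Stmt.goto fun _ => ULabel.copy)
  | .copy =>
    TM2.Stmt.pop Stk.inp (fun _ a => a) <|
      TM2.Stmt.branch (fun v => v.isSome)
        (TM2.Stmt.push Stk.aux (fun v => v.getD false) <| TM2.Stmt.load clear <|
          TM2.Stmt.goto fun _ => ULabel.copy)
        (TM2.Stmt.load clear <| TM2.Stmt.goto fun _ => ULabel.emit)
  | .emit =>
    TM2.Stmt.pop Stk.aux (fun _ a => a) <|
      TM2.Stmt.branch (fun v => v.isSome)
        (TM2.Stmt.push Stk.out (fun v => v.getD false) <| TM2.Stmt.load clear <|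
          TM2.Stmt.goto fun _ => ULabel.emit)
        (TM2.Stmt.load clear <| TM2.Stmt.halt)
  | _ => TM2.Stmt.halt

/-- The successor machine. [folklore] -/
def machine : FinTM2 where
  K := Stk
  kDecidableEq := inferInstance
  kFin := inferInstance
  k₀ := Stk.inp
  k₁ := Stk.out
  Γ := fun _ => Bool
  Λ := ULabel
  main := ULabel.read
  ΛFin := inferInstance
  σ := Option Bool
  initialState := none
  σFin := inferInstance
  Γk₀Fin := inferInstanceAs (Fintype Bool)
  m := prog

/-- Stack assignment. [folklore] -/
def stk (i a o : List Bool) : Stk → List Bool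
  | .inp => i
  | .aux => a
  | .out => o

/-- The input stack. [folklore] -/
@[simp] theorem stk_inp (i a o : List Bool) : stk i a o Stk.inp = i := rfl
/-- The auxiliary stack. [folklore] -/
@[simp] theorem stk_aux (i a o : List Bool) : stk i a o Stk.aux = a := rfl
/-- The output stack. [folklore] -/
@[simp] theorem stk_out (i a o : List Bool) : stk i a o Stk.out = o := rfl
/-- Updating the input stack. [folklore] -/
@[simp] theorem update_stk_inp (i a o l : List Bool) :
    Function.update (stk i a o) Stk.inp l = stk l a o := by funext k; cases k <;> rfl
/-- Updating the auxiliary stack. [folklore] -/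
@[simp] theorem update_stk_aux (i a o l : List Bool) :
    Function.update (stk i a o) Stk.aux l = stk i l o := by funext k; cases k <;> rfl
/-- Updating the output stack. [folklore] -/
@[simp] theorem update_stk_out (i a o l : List Bool) :
    Function.update (stk i a o) Stk.out l = stk i a l := by funext k; cases k <;> rfl

/-- Configurations with cleared register. [folklore] -/
def cfg (l : Option ULabel) (i a o : List Bool) : machine.Cfg := ⟨l, none, stk i a o⟩

/-- The step function with canonical instances. [folklore] -/
theorem machine_step (c : machine.Cfg) : machine.step c = TM2.step prog c := rfl

/-- `read` on `1`. [folklore] -/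
theorem step_read_true (u a o : List Bool) :
    machine.step (cfg (some .read) (true :: u) a o) = some (cfg (some .read) u (true :: a) o) := by
  rw [machine_step]; simp [cfg, TM2.step, prog, TM2.stepAux, clear]; rfl

/-- `read` on the terminator `0`. [folklore] -/
theorem step_read_false (u a o : List Bool) :
    machine.step (cfg (some .read) (false :: u) a o) =
      some (cfg (some .copy) u (true :: false :: a) o) := by
  rw [machine_step]; simp [cfg, TM2.step, prog, TM2.stepAux, clear]; rfl

/-- `read` on empty input. [folklore] -/
theorem step_read_nil (a o : List Bool) :
    machine.step (cfg (some .read) [] a o) = some (cfg (some .copy) [] (true :: false :: a) o) := by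
  rw [machine_step]; simp [cfg, TM2.step, prog, TM2.stepAux, clear]; rfl

/-- `copy` on a symbol. [folklore] -/
theorem step_copy_cons (c : Bool) (u a o : List Bool) :
    machine.step (cfg (some .copy) (c :: u) a o) = some (cfg (some .copy) u (c :: a) o) := by
  rw [machine_step]; simp [cfg, TM2.step, prog, TM2.stepAux, clear]; rfl

/-- `copy` on empty input. [folklore] -/
theorem step_copy_nil (a o : List Bool) :
    machine.step (cfg (some .copy) [] a o) = some (cfg (some .emit) [] a o) := by
  rw [machine_step]; simp [cfg, TM2.step, prog, TM2.stepAux, clear]; rfl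

/-- `emit` on a symbol. [folklore] -/
theorem step_emit_cons (c : Bool) (i a o : List Bool) :
    machine.step (cfg (some .emit) i (c :: a) o) = some (cfg (some .emit) i a (c :: o)) := by
  rw [machine_step]; simp [cfg, TM2.step, prog, TM2.stepAux, clear]; rfl

/-- `emit` on empty `aux` halts. [folklore] -/
theorem step_emit_nil (i o : List Bool) :
    machine.step (cfg (some .emit) i [] o) = some (cfg none i [] o) := by
  rw [machine_step]; simp [cfg, TM2.step, prog, TM2.stepAux, clear]; rfl

/-- The `read` phase. [folklore] -/
theorem iterate_read :
    ∀ u a o : List Bool,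
      (flip bind machine.step)^[(splitOnes u).1 + 1] (some (cfg (some .read) u a o)) =
        some (cfg (some .copy) (splitOnes u).2 (true :: false :: (ones (splitOnes u).1 ++ a)) o)
  | [], a, o => by
    rw [iterate_bind_succ]; simpa [splitOnes] using step_read_nil a o
  | true :: u, a, o => by
    simp only [splitOnes]
    rw [iterate_bind_succ, step_read_true, iterate_read u (true :: a) o]
    simp [ones, List.replicate_succ']
  | false :: u, a, o => by
    rw [iterate_bind_succ]; simpa [splitOnes] using step_read_false u a o

/-- The `copy` phase. [folklore] -/
theorem iterate_copy :
    ∀ r a o : List Bool,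
      (flip bind machine.step)^[r.length + 1] (some (cfg (some .copy) r a o)) =
        some (cfg (some .emit) [] (r.reverse ++ a) o)
  | [], a, o => by rw [List.length_nil, Nat.zero_add, iterate_bind_succ]; simpa using step_copy_nil a o
  | c :: r, a, o => by
    rw [List.length_cons, iterate_bind_succ, step_copy_cons, iterate_copy r (c :: a) o]; simp

/-- The `emit` phase. [folklore] -/
theorem iterate_emit (i : List Bool) :
    ∀ a o : List Bool,
      (flip bind machine.step)^[a.length + 1] (some (cfg (some .emit) i a o)) =
        some (cfg none i [] (a.reverse ++ o))
  | [], o => by rw [List.length_nil, Nat.zero_add, iterate_bind_succ]; simpa using step_emit_nil i o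
  | c :: a, o => by
    rw [List.length_cons, iterate_bind_succ, step_emit_cons, iterate_emit i a (c :: o)]; simp

/-- Number of steps on input `u`. [folklore] -/
def steps (u : List Bool) : ℕ :=
  ((succFn u).length + 1) + (((splitOnes u).2.length + 1) + ((splitOnes u).1 + 1))

/-- Linear running time: `steps u ≤ 2|u| + 5`. [folklore] -/
theorem steps_le (u : List Bool) : steps u ≤ 2 * u.length + 5 := by
  have h := splitOnes_le u
  simp only [steps, succFn, List.length_append, List.length_replicate, List.length_cons]
  omega

/-- The whole run: output `succFn u`, all other stacks empty. [folklore] -/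
theorem iterate_steps (u : List Bool) :
    (flip bind machine.step)^[steps u] (some (cfg (some .read) u [] [])) =
      some (cfg none [] [] (succFn u)) := by
  rw [steps, Function.iterate_add_apply _ ((succFn u).length + 1),
    Function.iterate_add_apply _ ((splitOnes u).2.length + 1), iterate_read, iterate_copy]
  have hr : succFn u = ((splitOnes u).2.reverse ++
      (true :: false :: (ones (splitOnes u).1 ++ []))).reverse := by
    simp [succFn, ones]
  have hlen : ∀ l : List Bool, l.length = l.reverse.length := fun l => by simp
  rw [hr, ← hlen, iterate_emit]
  simp

/-- Initial configuration. [folklore] -/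
theorem initList_eq (u : List Bool) : initList machine u = cfg (some .read) u [] [] := by
  refine TM2.Cfg.mk.injEq _ _ _ _ _ _ |>.mpr ⟨rfl, rfl, ?_⟩
  funext k; cases k
  · exact PairFstTM.initList_stk_self machine u
  · exact PairFstTM.initList_stk_ne machine u (k := Stk.aux) (fun h => Stk.noConfusion h)
  · exact PairFstTM.initList_stk_ne machine u (k := Stk.out) (fun h => Stk.noConfusion h)

/-- Halting configuration. [folklore] -/
theorem haltList_eq (o : List Bool) : haltList machine o = cfg none [] [] o := by
  refine TM2.Cfg.mk.injEq _ _ _ _ _ _ |>.mpr ⟨rfl, rfl, ?_⟩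
  funext k; cases k
  · exact PairFstTM.haltList_stk_ne machine o (k := Stk.inp) (fun h => Stk.noConfusion h)
  · exact PairFstTM.haltList_stk_ne machine o (k := Stk.aux) (fun h => Stk.noConfusion h)
  · exact PairFstTM.haltList_stk_self machine o

/-- The bundled successor machine. [folklore] -/
def aux : TM2ComputableAux Bool Bool where
  tm := machine
  inputAlphabet := Equiv.refl Bool
  outputAlphabet := Equiv.refl Bool

/-- Running time of the bundled successor machine. [folklore] -/
theorem outputsWithin (u : List Bool) : aux.OutputsWithin u (succFn u) (2 * u.length + 5) := by
  refine ⟨⟨⟨steps u, ?_⟩, steps_le u⟩⟩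
  change (flip bind machine.step)^[steps u] (some (initList machine (u.map id))) =
    some (haltList machine ((succFn u).map id))
  rw [List.map_id, List.map_id, initList_eq, haltList_eq]
  exact iterate_steps u

end SuccTM

open Polynomial in
/-- **The unary successor is in `FP`** (time `2n + 5`). [Arora–Barak 2009, §1.3]
[cite: AroraBarakCC2009, §1.3] -/
theorem succFn_mem_FP : succFn ∈ FP :=
  ⟨2 * X + 5, SuccTM.aux, fun u => (SuccTM.outputsWithin u).mono (by simp)⟩

/-- Iterates of the successor are in `FP`. [Arora–Barak 2009, §1.3, Thm. 2.8 (proof: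
composition)] [cite: AroraBarakCC2009, §1.3] -/
theorem iterate_succFn_mem_FP (b : ℕ) : succFn^[b] ∈ FP := by
  induction b with
  | zero => exact PolyTimeComputable.id (id : List Bool → List Bool)
  | succ b ih =>
    rw [Function.iterate_succ']
    exact PolyTimeComputable.comp_holds succFn_mem_FP ih

/-! ### The multiplication machine -/

namespace MulTM

open Turing StateTransition TM2Comp

/-- Stacks of the multiplication machine: input, first block `N`, its shuttle copy `N2`,
accumulator `A`, payload stash `S`, output. [folklore] -/
inductive Stk
  | inp
  | N
  | N2
  | A
  | S
  | out
  deriving DecidableEq, Fintype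

/-- Reset the register. [folklore] -/
def clear : Option Bool → Option Bool := fun _ => none

/-- Program: `read` loads the first block onto `N`; `outer` consumes the second block one `1`
at a time, each time adding `|N|` to `A` by shuttling `N` to `N2` (`inner`) and back (`back`);
`copy` stashes the payload; `emit`, `emitA`, `emitN` write payload, `0`, accumulator, `0`,
first block onto the output (bottom-up). [Arora–Barak 2009, §1.3] [cite: AroraBarakCC2009, §1.3] -/
def prog : ULabel → TM2.Stmt (fun _ : Stk => Bool) ULabel (Option Bool)
  | .read =>
    TM2.Stmt.pop Stk.inp (fun _ a => a) <|
      TM2.Stmt.branch (fun v => decide (v = some true))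
        (TM2.Stmt.push Stk.N (fun _ => true) <| TM2.Stmt.load clear <|
          TM2.Stmt.goto fun _ => ULabel.read)
        (TM2.Stmt.load clear <| TM2.Stmt.goto fun _ => ULabel.outer)
  | .outer =>
    TM2.Stmt.pop Stk.inp (fun _ a => a) <|
      TM2.Stmt.branch (fun v => decide (v = some true))
        (TM2.Stmt.load clear <| TM2.Stmt.goto fun _ => ULabel.inner)
        (TM2.Stmt.load clear <| TM2.Stmt.goto fun _ => ULabel.copy)
  | .inner =>
    TM2.Stmt.pop Stk.N (fun _ a => a) <|
      TM2.Stmt.branch (fun v => v.isSome)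
        (TM2.Stmt.push Stk.N2 (fun _ => true) <| TM2.Stmt.push Stk.A (fun _ => true) <|
          TM2.Stmt.load clear <| TM2.Stmt.goto fun _ => ULabel.inner)
        (TM2.Stmt.load clear <| TM2.Stmt.goto fun _ => ULabel.back)
  | .back =>
    TM2.Stmt.pop Stk.N2 (fun _ a => a) <|
      TM2.Stmt.branch (fun v => v.isSome)
        (TM2.Stmt.push Stk.N (fun _ => true) <| TM2.Stmt.load clear <|
          TM2.Stmt.goto fun _ => ULabel.back)
        (TM2.Stmt.load clear <| TM2.Stmt.goto fun _ => ULabel.outer)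
  | .copy =>
    TM2.Stmt.pop Stk.inp (fun _ a => a) <|
      TM2.Stmt.branch (fun v => v.isSome)
        (TM2.Stmt.push Stk.S (fun v => v.getD false) <| TM2.Stmt.load clear <|
          TM2.Stmt.goto fun _ => ULabel.copy)
        (TM2.Stmt.load clear <| TM2.Stmt.goto fun _ => ULabel.emit)
  | .emit =>
    TM2.Stmt.pop Stk.S (fun _ a => a) <|
      TM2.Stmt.branch (fun v => v.isSome)
        (TM2.Stmt.push Stk.out (fun v => v.getD false) <| TM2.Stmt.load clear <|
          TM2.Stmt.goto fun _ => ULabel.emit)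
        (TM2.Stmt.push Stk.out (fun _ => false) <| TM2.Stmt.load clear <|
          TM2.Stmt.goto fun _ => ULabel.emitA)
  | .emitA =>
    TM2.Stmt.pop Stk.A (fun _ a => a) <|
      TM2.Stmt.branch (fun v => v.isSome)
        (TM2.Stmt.push Stk.out (fun _ => true) <| TM2.Stmt.load clear <|
          TM2.Stmt.goto fun _ => ULabel.emitA)
        (TM2.Stmt.push Stk.out (fun _ => false) <| TM2.Stmt.load clear <|
          TM2.Stmt.goto fun _ => ULabel.emitN)
  | .emitN =>
    TM2.Stmt.pop Stk.N (fun _ a => a) <|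
      TM2.Stmt.branch (fun v => v.isSome)
        (TM2.Stmt.push Stk.out (fun _ => true) <| TM2.Stmt.load clear <|
          TM2.Stmt.goto fun _ => ULabel.emitN)
        (TM2.Stmt.load clear <| TM2.Stmt.halt)

/-- The multiplication machine. [Arora–Barak 2009, §1.3] [cite: AroraBarakCC2009, §1.3] -/
def machine : FinTM2 where
  K := Stk
  kDecidableEq := inferInstance
  kFin := inferInstance
  k₀ := Stk.inp
  k₁ := Stk.out
  Γ := fun _ => Bool
  Λ := ULabel
  main := ULabel.read
  ΛFin := inferInstance
  σ := Option Bool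
  initialState := none
  σFin := inferInstance
  Γk₀Fin := inferInstanceAs (Fintype Bool)
  m := prog

/-- Stack assignment (input, `N`, `N2`, `A`, `S`, output). [folklore] -/
def stk (i n n' a s o : List Bool) : Stk → List Bool
  | .inp => i
  | .N => n
  | .N2 => n'
  | .A => a
  | .S => s
  | .out => o

/-- The input stack. [folklore] -/
@[simp] theorem stk_inp (i n n' a s o : List Bool) : stk i n n' a s o Stk.inp = i := rfl
/-- The `N` stack. [folklore] -/
@[simp] theorem stk_N (i n n' a s o : List Bool) : stk i n n' a s o Stk.N = n := rfl
/-- The `N2` stack. [folklore] -/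
@[simp] theorem stk_N2 (i n n' a s o : List Bool) : stk i n n' a s o Stk.N2 = n' := rfl
/-- The `A` stack. [folklore] -/
@[simp] theorem stk_A (i n n' a s o : List Bool) : stk i n n' a s o Stk.A = a := rfl
/-- The `S` stack. [folklore] -/
@[simp] theorem stk_S (i n n' a s o : List Bool) : stk i n n' a s o Stk.S = s := rfl
/-- The output stack. [folklore] -/
@[simp] theorem stk_out (i n n' a s o : List Bool) : stk i n n' a s o Stk.out = o := rfl
/-- Updating the input stack. [folklore] -/
@[simp] theorem update_stk_inp (i n n' a s o l : List Bool) :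
    Function.update (stk i n n' a s o) Stk.inp l = stk l n n' a s o := by funext k; cases k <;> rfl
/-- Updating `N`. [folklore] -/
@[simp] theorem update_stk_N (i n n' a s o l : List Bool) :
    Function.update (stk i n n' a s o) Stk.N l = stk i l n' a s o := by funext k; cases k <;> rfl
/-- Updating `N2`. [folklore] -/
@[simp] theorem update_stk_N2 (i n n' a s o l : List Bool) :
    Function.update (stk i n n' a s o) Stk.N2 l = stk i n l a s o := by funext k; cases k <;> rfl
/-- Updating `A`. [folklore] -/
@[simp] theorem update_stk_A (i n n' a s o l : List Bool) :
    Function.update (stk i n n' a s o) Stk.A l = stk i n n' l s o := by funext k; cases k <;> rfl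
/-- Updating `S`. [folklore] -/
@[simp] theorem update_stk_S (i n n' a s o l : List Bool) :
    Function.update (stk i n n' a s o) Stk.S l = stk i n n' a l o := by funext k; cases k <;> rfl
/-- Updating the output stack. [folklore] -/
@[simp] theorem update_stk_out (i n n' a s o l : List Bool) :
    Function.update (stk i n n' a s o) Stk.out l = stk i n n' a s l := by funext k; cases k <;> rfl

/-- Configurations with cleared register. [folklore] -/
def cfg (l : Option ULabel) (i n n' a s o : List Bool) : machine.Cfg := ⟨l, none, stk i n n' a s o⟩

/-- The step function with canonical instances. [folklore] -/
theorem machine_step (c : machine.Cfg) : machine.step c = TM2.step prog c := rfl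

/-- One iterated step. [folklore] -/
theorem iter_one (c : machine.Cfg) : (flip bind machine.step)^[1] (some c) = machine.step c := rfl

/-- `read` on `1`: push onto `N`. [folklore] -/
theorem step_read_true (u n n' a s o : List Bool) :
    machine.step (cfg (some .read) (true :: u) n n' a s o) =
      some (cfg (some .read) u (true :: n) n' a s o) := by
  rw [machine_step]; simp [cfg, TM2.step, prog, TM2.stepAux, clear]; rfl

/-- `read` on the terminator. [folklore] -/
theorem step_read_false (u n n' a s o : List Bool) :
    machine.step (cfg (some .read) (false :: u) n n' a s o) =
      some (cfg (some .outer) u n n' a s o) := by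
  rw [machine_step]; simp [cfg, TM2.step, prog, TM2.stepAux, clear]; rfl

/-- `read` on empty input. [folklore] -/
theorem step_read_nil (n n' a s o : List Bool) :
    machine.step (cfg (some .read) [] n n' a s o) = some (cfg (some .outer) [] n n' a s o) := by
  rw [machine_step]; simp [cfg, TM2.step, prog, TM2.stepAux, clear]; rfl

/-- `outer` on `1`: start one addition of `|N|`. [folklore] -/
theorem step_outer_true (u n n' a s o : List Bool) :
    machine.step (cfg (some .outer) (true :: u) n n' a s o) =
      some (cfg (some .inner) u n n' a s o) := by
  rw [machine_step]; simp [cfg, TM2.step, prog, TM2.stepAux, clear]; rfl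

/-- `outer` on the terminator: switch to `copy`. [folklore] -/
theorem step_outer_false (u n n' a s o : List Bool) :
    machine.step (cfg (some .outer) (false :: u) n n' a s o) =
      some (cfg (some .copy) u n n' a s o) := by
  rw [machine_step]; simp [cfg, TM2.step, prog, TM2.stepAux, clear]; rfl

/-- `outer` on empty input: switch to `copy`. [folklore] -/
theorem step_outer_nil (n n' a s o : List Bool) :
    machine.step (cfg (some .outer) [] n n' a s o) = some (cfg (some .copy) [] n n' a s o) := by
  rw [machine_step]; simp [cfg, TM2.step, prog, TM2.stepAux, clear]; rfl

/-- `inner`: move one symbol of `N` to `N2` and add one to `A`. [folklore] -/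
theorem step_inner_cons (c : Bool) (i n n' a s o : List Bool) :
    machine.step (cfg (some .inner) i (c :: n) n' a s o) =
      some (cfg (some .inner) i n (true :: n') (true :: a) s o) := by
  rw [machine_step]; simp [cfg, TM2.step, prog, TM2.stepAux, clear]; rfl

/-- `inner` on empty `N`: switch to `back`. [folklore] -/
theorem step_inner_nil (i n' a s o : List Bool) :
    machine.step (cfg (some .inner) i [] n' a s o) = some (cfg (some .back) i [] n' a s o) := by
  rw [machine_step]; simp [cfg, TM2.step, prog, TM2.stepAux, clear]; rfl

/-- `back`: move one symbol of `N2` back to `N`. [folklore] -/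
theorem step_back_cons (c : Bool) (i n n' a s o : List Bool) :
    machine.step (cfg (some .back) i n (c :: n') a s o) =
      some (cfg (some .back) i (true :: n) n' a s o) := by
  rw [machine_step]; simp [cfg, TM2.step, prog, TM2.stepAux, clear]; rfl

/-- `back` on empty `N2`: return to `outer`. [folklore] -/
theorem step_back_nil (i n a s o : List Bool) :
    machine.step (cfg (some .back) i n [] a s o) = some (cfg (some .outer) i n [] a s o) := by
  rw [machine_step]; simp [cfg, TM2.step, prog, TM2.stepAux, clear]; rfl

/-- `copy` on a symbol. [folklore] -/
theorem step_copy_cons (c : Bool) (u n n' a s o : List Bool) :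
    machine.step (cfg (some .copy) (c :: u) n n' a s o) =
      some (cfg (some .copy) u n n' a (c :: s) o) := by
  rw [machine_step]; simp [cfg, TM2.step, prog, TM2.stepAux, clear]; rfl

/-- `copy` on empty input. [folklore] -/
theorem step_copy_nil (n n' a s o : List Bool) :
    machine.step (cfg (some .copy) [] n n' a s o) = some (cfg (some .emit) [] n n' a s o) := by
  rw [machine_step]; simp [cfg, TM2.step, prog, TM2.stepAux, clear]; rfl

/-- `emit` on a symbol. [folklore] -/
theorem step_emit_cons (c : Bool) (i n n' a s o : List Bool) :
    machine.step (cfg (some .emit) i n n' a (c :: s) o) =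
      some (cfg (some .emit) i n n' a s (c :: o)) := by
  rw [machine_step]; simp [cfg, TM2.step, prog, TM2.stepAux, clear]; rfl

/-- `emit` on empty stash: write the terminator, switch to `emitA`. [folklore] -/
theorem step_emit_nil (i n n' a o : List Bool) :
    machine.step (cfg (some .emit) i n n' a [] o) =
      some (cfg (some .emitA) i n n' a [] (false :: o)) := by
  rw [machine_step]; simp [cfg, TM2.step, prog, TM2.stepAux, clear]; rfl

/-- `emitA` on a symbol. [folklore] -/
theorem step_emitA_cons (c : Bool) (i n n' a s o : List Bool) :
    machine.step (cfg (some .emitA) i n n' (c :: a) s o) =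
      some (cfg (some .emitA) i n n' a s (true :: o)) := by
  rw [machine_step]; simp [cfg, TM2.step, prog, TM2.stepAux, clear]; rfl

/-- `emitA` on empty accumulator: write the terminator, switch to `emitN`. [folklore] -/
theorem step_emitA_nil (i n n' s o : List Bool) :
    machine.step (cfg (some .emitA) i n n' [] s o) =
      some (cfg (some .emitN) i n n' [] s (false :: o)) := by
  rw [machine_step]; simp [cfg, TM2.step, prog, TM2.stepAux, clear]; rfl

/-- `emitN` on a symbol. [folklore] -/
theorem step_emitN_cons (c : Bool) (i n n' a s o : List Bool) :
    machine.step (cfg (some .emitN) i (c :: n) n' a s o) =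
      some (cfg (some .emitN) i n n' a s (true :: o)) := by
  rw [machine_step]; simp [cfg, TM2.step, prog, TM2.stepAux, clear]; rfl

/-- `emitN` on empty `N` halts. [folklore] -/
theorem step_emitN_nil (i n' a s o : List Bool) :
    machine.step (cfg (some .emitN) i [] n' a s o) = some (cfg none i [] n' a s o) := by
  rw [machine_step]; simp [cfg, TM2.step, prog, TM2.stepAux, clear]; rfl

/-- The `read` phase loads the first block onto `N`. [folklore] -/
theorem iterate_read :
    ∀ u n n' a s o : List Bool,
      (flip bind machine.step)^[(splitOnes u).1 + 1] (some (cfg (some .read) u n n' a s o)) =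
        some (cfg (some .outer) (splitOnes u).2 (ones (splitOnes u).1 ++ n) n' a s o)
  | [], n, n', a, s, o => by
    rw [iterate_bind_succ]; simpa [splitOnes] using step_read_nil n n' a s o
  | true :: u, n, n', a, s, o => by
    simp only [splitOnes]
    rw [iterate_bind_succ, step_read_true, iterate_read u (true :: n) n' a s o]
    simp [ones, List.replicate_succ']
  | false :: u, n, n', a, s, o => by
    rw [iterate_bind_succ]; simpa [splitOnes] using step_read_false u n n' a s o

/-- The `inner` phase: `A += |N|`, `N` shuttled to `N2`. [folklore] -/
theorem iterate_inner (i s o : List Bool) :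
    ∀ (j : ℕ) (n' a : List Bool),
      (flip bind machine.step)^[j + 1] (some (cfg (some .inner) i (ones j) n' a s o)) =
        some (cfg (some .back) i [] (ones j ++ n') (ones j ++ a) s o)
  | 0, n', a => by rw [iterate_bind_succ]; simpa using step_inner_nil i n' a s o
  | j + 1, n', a => by
    rw [iterate_bind_succ, show ones (j + 1) = true :: ones j from rfl, step_inner_cons,
      iterate_inner i s o j (true :: n') (true :: a)]
    simp [ones]

/-- The `back` phase: `N2` shuttled back to `N`. [folklore] -/
theorem iterate_back (i a s o : List Bool) :
    ∀ (j : ℕ) (n : List Bool),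
      (flip bind machine.step)^[j + 1] (some (cfg (some .back) i n (ones j) a s o)) =
        some (cfg (some .outer) i (ones j ++ n) [] a s o)
  | 0, n => by rw [iterate_bind_succ]; simpa using step_back_nil i n a s o
  | j + 1, n => by
    rw [iterate_bind_succ, show ones (j + 1) = true :: ones j from rfl, step_back_cons,
      iterate_back i a s o j (true :: n)]
    simp [ones]

/-- The `outer` loop: `A += a · k` where `a` is the second block and `k = |N|`. [Arora–Barak
2009, §1.3] [cite: AroraBarakCC2009, §1.3] -/
theorem iterate_outer (k : ℕ) (s o : List Bool) :
    ∀ u a : List Bool,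
      (flip bind machine.step)^[(splitOnes u).1 * (2 * k + 3) + 1]
          (some (cfg (some .outer) u (ones k) [] a s o)) =
        some (cfg (some .copy) (splitOnes u).2 (ones k) [] (ones ((splitOnes u).1 * k) ++ a) s o)
  | [], a => by
    rw [show (splitOnes []).1 * (2 * k + 3) + 1 = 0 + 1 by simp [splitOnes], iterate_bind_succ]
    simpa [splitOnes] using step_outer_nil (ones k) [] a s o
  | false :: u, a => by
    rw [show (splitOnes (false :: u)).1 * (2 * k + 3) + 1 = 0 + 1 by simp [splitOnes],
      iterate_bind_succ]
    simpa [splitOnes] using step_outer_false u (ones k) [] a s o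
  | true :: u, a => by
    have hsplit : splitOnes (true :: u) = ((splitOnes u).1 + 1, (splitOnes u).2) := rfl
    rw [hsplit]
    dsimp only
    rw [show ((splitOnes u).1 + 1) * (2 * k + 3) + 1 =
        ((splitOnes u).1 * (2 * k + 3) + 1) + ((k + 1) + ((k + 1) + 1)) by ring,
      Function.iterate_add_apply _ ((splitOnes u).1 * (2 * k + 3) + 1),
      Function.iterate_add_apply _ (k + 1), Function.iterate_add_apply _ (k + 1), iter_one,
      step_outer_true, iterate_inner, List.append_nil, iterate_back, List.append_nil,
      iterate_outer k s o u]
    simp only [ones, Nat.succ_mul, List.replicate_add, List.append_assoc]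

/-- The `copy` phase. [folklore] -/
theorem iterate_copy (n n' a o : List Bool) :
    ∀ r s : List Bool,
      (flip bind machine.step)^[r.length + 1] (some (cfg (some .copy) r n n' a s o)) =
        some (cfg (some .emit) [] n n' a (r.reverse ++ s) o)
  | [], s => by
    rw [List.length_nil, Nat.zero_add, iterate_bind_succ]; simpa using step_copy_nil n n' a s o
  | c :: r, s => by
    rw [List.length_cons, iterate_bind_succ, step_copy_cons, iterate_copy n n' a o r (c :: s)]
    simp

/-- The `emit` phase. [folklore] -/
theorem iterate_emit (i n n' a : List Bool) :
    ∀ s o : List Bool,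
      (flip bind machine.step)^[s.length + 1] (some (cfg (some .emit) i n n' a s o)) =
        some (cfg (some .emitA) i n n' a [] (false :: (s.reverse ++ o)))
  | [], o => by
    rw [List.length_nil, Nat.zero_add, iterate_bind_succ]; simpa using step_emit_nil i n n' a o
  | c :: s, o => by
    rw [List.length_cons, iterate_bind_succ, step_emit_cons, iterate_emit i n n' a s (c :: o)]
    simp

/-- The `emitA` phase. [folklore] -/
theorem iterate_emitA (i n n' s : List Bool) :
    ∀ (j : ℕ) (o : List Bool),
      (flip bind machine.step)^[j + 1] (some (cfg (some .emitA) i n n' (ones j) s o)) =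
        some (cfg (some .emitN) i n n' [] s (false :: (ones j ++ o)))
  | 0, o => by rw [iterate_bind_succ]; simpa using step_emitA_nil i n n' s o
  | j + 1, o => by
    rw [iterate_bind_succ, show ones (j + 1) = true :: ones j from rfl, step_emitA_cons,
      iterate_emitA i n n' s j (true :: o)]
    simp [ones]

/-- The `emitN` phase. [folklore] -/
theorem iterate_emitN (i n' a s : List Bool) :
    ∀ (j : ℕ) (o : List Bool),
      (flip bind machine.step)^[j + 1] (some (cfg (some .emitN) i (ones j) n' a s o)) =
        some (cfg none i [] n' a s (ones j ++ o))
  | 0, o => by rw [iterate_bind_succ]; simpa using step_emitN_nil i n' a s o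
  | j + 1, o => by
    rw [iterate_bind_succ, show ones (j + 1) = true :: ones j from rfl, step_emitN_cons,
      iterate_emitN i n' a s j (true :: o)]
    simp [ones]

/-- First block, second block and payload of the input. [folklore] -/
def kOf (u : List Bool) : ℕ := (splitOnes u).1
/-- Second block of the input. [folklore] -/
def aOf (u : List Bool) : ℕ := (splitOnes (splitOnes u).2).1
/-- Payload of the input. [folklore] -/
def zOf (u : List Bool) : List Bool := (splitOnes (splitOnes u).2).2

/-- Number of steps on input `u`. [folklore] -/
def steps (u : List Bool) : ℕ :=
  (kOf u + 1) + ((aOf u * kOf u + 1) + (((zOf u).length + 1) + (((zOf u).length + 1) +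
    ((aOf u * (2 * kOf u + 3) + 1) + (kOf u + 1)))))

/-- Quadratic running time: `steps u ≤ 3|u|² + 7|u| + 6`. [Arora–Barak 2009, §1.3]
[cite: AroraBarakCC2009, §1.3] -/
theorem steps_le (u : List Bool) : steps u ≤ 3 * (u.length * u.length) + 7 * u.length + 6 := by
  have h₁ := splitOnes_le u
  have h₂ := splitOnes_le (splitOnes u).2
  have hk : kOf u ≤ u.length := by unfold kOf; omega
  have ha : aOf u ≤ u.length := by unfold aOf; omega
  have hz : (zOf u).length + aOf u + kOf u ≤ u.length := by unfold zOf aOf kOf; omega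
  have hak : aOf u * kOf u ≤ u.length * u.length := Nat.mul_le_mul ha hk
  have hexp : aOf u * (2 * kOf u + 3) = 2 * (aOf u * kOf u) + 3 * aOf u := by ring
  unfold steps
  rw [hexp]
  omega

/-- The whole run: output `mulFn u`, all other stacks empty. [Arora–Barak 2009, §1.3]
[cite: AroraBarakCC2009, §1.3] -/
theorem iterate_steps (u : List Bool) :
    (flip bind machine.step)^[steps u] (some (cfg (some .read) u [] [] [] [] [])) =
      some (cfg none [] [] [] [] [] (mulFn u)) := by
  rw [steps, Function.iterate_add_apply _ (kOf u + 1),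
    Function.iterate_add_apply _ (aOf u * kOf u + 1),
    Function.iterate_add_apply _ ((zOf u).length + 1),
    Function.iterate_add_apply _ ((zOf u).length + 1),
    Function.iterate_add_apply _ (aOf u * (2 * kOf u + 3) + 1)]
  unfold kOf aOf zOf
  rw [iterate_read, List.append_nil, iterate_outer, List.append_nil, iterate_copy,
    List.append_nil]
  have hlen : ∀ l : List Bool, l.length = l.reverse.length := fun l => by simp
  rw [hlen (splitOnes (splitOnes u).2).2, iterate_emit, List.reverse_reverse, iterate_emitA,
    iterate_emitN]
  simp [mulFn, hdr]

/-- Initial configuration. [folklore] -/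
theorem initList_eq (u : List Bool) : initList machine u = cfg (some .read) u [] [] [] [] [] := by
  refine TM2.Cfg.mk.injEq _ _ _ _ _ _ |>.mpr ⟨rfl, rfl, ?_⟩
  funext k; cases k
  · exact PairFstTM.initList_stk_self machine u
  · exact PairFstTM.initList_stk_ne machine u (k := Stk.N) (fun h => Stk.noConfusion h)
  · exact PairFstTM.initList_stk_ne machine u (k := Stk.N2) (fun h => Stk.noConfusion h)
  · exact PairFstTM.initList_stk_ne machine u (k := Stk.A) (fun h => Stk.noConfusion h)
  · exact PairFstTM.initList_stk_ne machine u (k := Stk.S) (fun h => Stk.noConfusion h)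
  · exact PairFstTM.initList_stk_ne machine u (k := Stk.out) (fun h => Stk.noConfusion h)

/-- Halting configuration. [folklore] -/
theorem haltList_eq (o : List Bool) : haltList machine o = cfg none [] [] [] [] [] o := by
  refine TM2.Cfg.mk.injEq _ _ _ _ _ _ |>.mpr ⟨rfl, rfl, ?_⟩
  funext k; cases k
  · exact PairFstTM.haltList_stk_ne machine o (k := Stk.inp) (fun h => Stk.noConfusion h)
  · exact PairFstTM.haltList_stk_ne machine o (k := Stk.N) (fun h => Stk.noConfusion h)
  · exact PairFstTM.haltList_stk_ne machine o (k := Stk.N2) (fun h => Stk.noConfusion h)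
  · exact PairFstTM.haltList_stk_ne machine o (k := Stk.A) (fun h => Stk.noConfusion h)
  · exact PairFstTM.haltList_stk_ne machine o (k := Stk.S) (fun h => Stk.noConfusion h)
  · exact PairFstTM.haltList_stk_self machine o

/-- The bundled multiplication machine. [folklore] -/
def aux : TM2ComputableAux Bool Bool where
  tm := machine
  inputAlphabet := Equiv.refl Bool
  outputAlphabet := Equiv.refl Bool

/-- Running time of the bundled multiplication machine. [Arora–Barak 2009, §1.3]
[cite: AroraBarakCC2009, §1.3] -/
theorem outputsWithin (u : List Bool) :
    aux.OutputsWithin u (mulFn u) (3 * (u.length * u.length) + 7 * u.length + 6) := by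
  refine ⟨⟨⟨steps u, ?_⟩, steps_le u⟩⟩
  change (flip bind machine.step)^[steps u] (some (initList machine (u.map id))) =
    some (haltList machine ((mulFn u).map id))
  rw [List.map_id, List.map_id, initList_eq, haltList_eq]
  exact iterate_steps u

end MulTM

open Polynomial in
/-- **Unary multiplication of the accumulator by the first block is in `FP`** (time
`3n² + 7n + 6`). [Arora–Barak 2009, §1.3] [cite: AroraBarakCC2009, §1.3] -/
theorem mulFn_mem_FP : mulFn ∈ FP :=
  ⟨3 * (X * X) + 7 * X + 6, MulTM.aux, fun u => (MulTM.outputsWithin u).mono (by simp)⟩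

/-! ### The initial-header machine -/

namespace InitTM

open Turing StateTransition TM2Comp PairFstTM

/-- The part of the input consumed by the pair-reading phase (`readPrefix z ++ readRest z = z`).
[folklore] -/
def readPrefix : List Bool → List Bool
  | b :: b' :: rest => if b = b' then b :: b' :: readPrefix rest else [b, b']
  | [b] => [b]
  | [] => []

/-- The reading phase splits the input. [folklore] -/
theorem readPrefix_append_readRest : ∀ z : List Bool, readPrefix z ++ readRest z = z
  | [] => rfl
  | [_] => rfl
  | b :: b' :: rest => by
    by_cases h : b = b'
    · subst h; simp [readPrefix, readRest, readPrefix_append_readRest rest]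
    · simp [readPrefix, readRest, h]

/-- Stacks of the initial-header machine: input, payload stash, counter, output. [folklore] -/
inductive Stk
  | inp
  | S
  | N
  | out
  deriving DecidableEq, Fintype

/-- States: two registers. [folklore] -/
abbrev State : Type := Option Bool × Option Bool

/-- Reset the registers. [folklore] -/
def clear : State → State := fun _ => (none, none)

/-- Program: `read` pops the input two symbols at a time, stashing them on `S` and counting
equal pairs on `N`, until the first unequal / incomplete pair; `copy` stashes the rest; `emit`
writes the payload back, then `0, 0`; `emitN` writes the counter. Output `hdr |x| 0 z`.
[Arora–Barak 2009, §0.1 (pairing), §1.3] [cite: AroraBarakCC2009, §1.3] -/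
def prog : ULabel → TM2.Stmt (fun _ : Stk => Bool) ULabel State
  | .read =>
    TM2.Stmt.pop Stk.inp (fun v a => (a, v.2)) <|
      TM2.Stmt.pop Stk.inp (fun v a => (v.1, a)) <|
        TM2.Stmt.branch (fun v => v.1.isSome && v.2.isSome)
          (TM2.Stmt.push Stk.S (fun v => v.1.getD false) <|
            TM2.Stmt.push Stk.S (fun v => v.2.getD false) <|
              TM2.Stmt.branch (fun v => pairOK v.1 v.2)
                (TM2.Stmt.push Stk.N (fun _ => true) <| TM2.Stmt.load clear <|
                  TM2.Stmt.goto fun _ => ULabel.read)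
                (TM2.Stmt.load clear <| TM2.Stmt.goto fun _ => ULabel.copy))
          (TM2.Stmt.branch (fun v => v.1.isSome)
            (TM2.Stmt.push Stk.S (fun v => v.1.getD false) <| TM2.Stmt.load clear <|
              TM2.Stmt.goto fun _ => ULabel.copy)
            (TM2.Stmt.load clear <| TM2.Stmt.goto fun _ => ULabel.copy))
  | .copy =>
    TM2.Stmt.pop Stk.inp (fun _ a => (a, none)) <|
      TM2.Stmt.branch (fun v => v.1.isSome)
        (TM2.Stmt.push Stk.S (fun v => v.1.getD false) <| TM2.Stmt.load clear <|
          TM2.Stmt.goto fun _ => ULabel.copy)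
        (TM2.Stmt.load clear <| TM2.Stmt.goto fun _ => ULabel.emit)
  | .emit =>
    TM2.Stmt.pop Stk.S (fun _ a => (a, none)) <|
      TM2.Stmt.branch (fun v => v.1.isSome)
        (TM2.Stmt.push Stk.out (fun v => v.1.getD false) <| TM2.Stmt.load clear <|
          TM2.Stmt.goto fun _ => ULabel.emit)
        (TM2.Stmt.push Stk.out (fun _ => false) <| TM2.Stmt.push Stk.out (fun _ => false) <|
          TM2.Stmt.load clear <| TM2.Stmt.goto fun _ => ULabel.emitN)
  | .emitN =>
    TM2.Stmt.pop Stk.N (fun _ a => (a, none)) <|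
      TM2.Stmt.branch (fun v => v.1.isSome)
        (TM2.Stmt.push Stk.out (fun _ => true) <| TM2.Stmt.load clear <|
          TM2.Stmt.goto fun _ => ULabel.emitN)
        (TM2.Stmt.load clear <| TM2.Stmt.halt)
  | _ => TM2.Stmt.halt

/-- The initial-header machine. [Arora–Barak 2009, §1.3] [cite: AroraBarakCC2009, §1.3] -/
def machine : FinTM2 where
  K := Stk
  kDecidableEq := inferInstance
  kFin := inferInstance
  k₀ := Stk.inp
  k₁ := Stk.out
  Γ := fun _ => Bool
  Λ := ULabel
  main := ULabel.read
  ΛFin := inferInstance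
  σ := State
  initialState := (none, none)
  σFin := inferInstance
  Γk₀Fin := inferInstanceAs (Fintype Bool)
  m := prog

/-- Stack assignment (input, stash, counter, output). [folklore] -/
def stk (i s n o : List Bool) : Stk → List Bool
  | .inp => i
  | .S => s
  | .N => n
  | .out => o

/-- The input stack. [folklore] -/
@[simp] theorem stk_inp (i s n o : List Bool) : stk i s n o Stk.inp = i := rfl
/-- The stash. [folklore] -/
@[simp] theorem stk_S (i s n o : List Bool) : stk i s n o Stk.S = s := rfl
/-- The counter. [folklore] -/
@[simp] theorem stk_N (i s n o : List Bool) : stk i s n o Stk.N = n := rfl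
/-- The output stack. [folklore] -/
@[simp] theorem stk_out (i s n o : List Bool) : stk i s n o Stk.out = o := rfl
/-- Updating the input stack. [folklore] -/
@[simp] theorem update_stk_inp (i s n o l : List Bool) :
    Function.update (stk i s n o) Stk.inp l = stk l s n o := by funext k; cases k <;> rfl
/-- Updating the stash. [folklore] -/
@[simp] theorem update_stk_S (i s n o l : List Bool) :
    Function.update (stk i s n o) Stk.S l = stk i l n o := by funext k; cases k <;> rfl
/-- Updating the counter. [folklore] -/
@[simp] theorem update_stk_N (i s n o l : List Bool) :
    Function.update (stk i s n o) Stk.N l = stk i s l o := by funext k; cases k <;> rfl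
/-- Updating the output stack. [folklore] -/
@[simp] theorem update_stk_out (i s n o l : List Bool) :
    Function.update (stk i s n o) Stk.out l = stk i s n l := by funext k; cases k <;> rfl

/-- Configurations with cleared registers. [folklore] -/
def cfg (l : Option ULabel) (i s n o : List Bool) : machine.Cfg := ⟨l, (none, none), stk i s n o⟩

/-- The step function with canonical instances. [folklore] -/
theorem machine_step (c : machine.Cfg) : machine.step c = TM2.step prog c := rfl

/-- `read` on a doubled pair: stash it and count. [folklore] -/
theorem step_read_cons_cons_self (b : Bool) (rest s n o : List Bool) :
    machine.step (cfg (some .read) (b :: b :: rest) s n o) =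
      some (cfg (some .read) rest (b :: b :: s) (true :: n) o) := by
  rw [machine_step]; simp [cfg, TM2.step, prog, TM2.stepAux, clear, pairOK]; rfl

/-- `read` on an unequal pair: stash it and switch to `copy`. [folklore] -/
theorem step_read_cons_cons_ne {b b' : Bool} (h : b ≠ b') (rest s n o : List Bool) :
    machine.step (cfg (some .read) (b :: b' :: rest) s n o) =
      some (cfg (some .copy) rest (b' :: b :: s) n o) := by
  rw [machine_step]; simp [cfg, TM2.step, prog, TM2.stepAux, clear, pairOK, h]; rfl

/-- `read` on a single leftover symbol. [folklore] -/
theorem step_read_single (b : Bool) (s n o : List Bool) :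
    machine.step (cfg (some .read) [b] s n o) = some (cfg (some .copy) [] (b :: s) n o) := by
  rw [machine_step]; simp [cfg, TM2.step, prog, TM2.stepAux, clear]; rfl

/-- `read` on empty input. [folklore] -/
theorem step_read_nil (s n o : List Bool) :
    machine.step (cfg (some .read) [] s n o) = some (cfg (some .copy) [] s n o) := by
  rw [machine_step]; simp [cfg, TM2.step, prog, TM2.stepAux, clear]; rfl

/-- `copy` on a symbol. [folklore] -/
theorem step_copy_cons (c : Bool) (u s n o : List Bool) :
    machine.step (cfg (some .copy) (c :: u) s n o) = some (cfg (some .copy) u (c :: s) n o) := by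
  rw [machine_step]; simp [cfg, TM2.step, prog, TM2.stepAux, clear]; rfl

/-- `copy` on empty input. [folklore] -/
theorem step_copy_nil (s n o : List Bool) :
    machine.step (cfg (some .copy) [] s n o) = some (cfg (some .emit) [] s n o) := by
  rw [machine_step]; simp [cfg, TM2.step, prog, TM2.stepAux, clear]; rfl

/-- `emit` on a symbol. [folklore] -/
theorem step_emit_cons (c : Bool) (i s n o : List Bool) :
    machine.step (cfg (some .emit) i (c :: s) n o) = some (cfg (some .emit) i s n (c :: o)) := by
  rw [machine_step]; simp [cfg, TM2.step, prog, TM2.stepAux, clear]; rfl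

/-- `emit` on empty stash: write `0, 0`, switch to `emitN`. [folklore] -/
theorem step_emit_nil (i n o : List Bool) :
    machine.step (cfg (some .emit) i [] n o) =
      some (cfg (some .emitN) i [] n (false :: false :: o)) := by
  rw [machine_step]; simp [cfg, TM2.step, prog, TM2.stepAux, clear]; rfl

/-- `emitN` on a symbol. [folklore] -/
theorem step_emitN_cons (c : Bool) (i s n o : List Bool) :
    machine.step (cfg (some .emitN) i s (c :: n) o) = some (cfg (some .emitN) i s n (true :: o)) := by
  rw [machine_step]; simp [cfg, TM2.step, prog, TM2.stepAux, clear]; rfl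

/-- `emitN` on empty counter halts. [folklore] -/
theorem step_emitN_nil (i s o : List Bool) :
    machine.step (cfg (some .emitN) i s [] o) = some (cfg none i s [] o) := by
  rw [machine_step]; simp [cfg, TM2.step, prog, TM2.stepAux, clear]; rfl

/-- The `read` phase: stash the consumed prefix (reversed), count `|(boolUnpair z).1|`.
[folklore] -/
theorem iterate_read :
    ∀ z s n o : List Bool,
      (flip bind machine.step)^[readSteps z] (some (cfg (some .read) z s n o)) =
        some (cfg (some .copy) (readRest z) ((readPrefix z).reverse ++ s)
          (ones (boolUnpair z).1.length ++ n) o)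
  | [], s, n, o => by
    simp only [readSteps, Function.iterate_one, readRest, readPrefix, List.reverse_nil,
      List.nil_append, PairFstTM.boolUnpair_fst_nil, List.length_nil]
    exact step_read_nil s n o
  | [b], s, n, o => by
    simp only [readSteps, Function.iterate_one, readRest, readPrefix, List.reverse_singleton,
      List.singleton_append, PairFstTM.boolUnpair_fst_single, List.length_nil]
    exact step_read_single b s n o
  | b :: b' :: rest, s, n, o => by
    by_cases h : b = b'
    · subst h
      simp only [readSteps, readRest, readPrefix, boolUnpair_fst_cons_cons, if_true]
      rw [iterate_bind_succ, step_read_cons_cons_self, iterate_read rest (b :: b :: s) (true :: n) o]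
      simp [ones, List.replicate_succ]
    · simp only [readSteps, readRest, readPrefix, boolUnpair_fst_cons_cons, if_neg h,
        Function.iterate_one]
      change machine.step (cfg (some .read) (b :: b' :: rest) s n o) = _
      rw [step_read_cons_cons_ne h]
      simp

/-- The `copy` phase. [folklore] -/
theorem iterate_copy (n o : List Bool) :
    ∀ r s : List Bool,
      (flip bind machine.step)^[r.length + 1] (some (cfg (some .copy) r s n o)) =
        some (cfg (some .emit) [] (r.reverse ++ s) n o)
  | [], s => by
    rw [List.length_nil, Nat.zero_add, iterate_bind_succ]; simpa using step_copy_nil s n o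
  | c :: r, s => by
    rw [List.length_cons, iterate_bind_succ, step_copy_cons, iterate_copy n o r (c :: s)]; simp

/-- The `emit` phase. [folklore] -/
theorem iterate_emit (i n : List Bool) :
    ∀ s o : List Bool,
      (flip bind machine.step)^[s.length + 1] (some (cfg (some .emit) i s n o)) =
        some (cfg (some .emitN) i [] n (false :: false :: (s.reverse ++ o)))
  | [], o => by
    rw [List.length_nil, Nat.zero_add, iterate_bind_succ]; simpa using step_emit_nil i n o
  | c :: s, o => by
    rw [List.length_cons, iterate_bind_succ, step_emit_cons, iterate_emit i n s (c :: o)]; simp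

/-- The `emitN` phase. [folklore] -/
theorem iterate_emitN (i s : List Bool) :
    ∀ (j : ℕ) (o : List Bool),
      (flip bind machine.step)^[j + 1] (some (cfg (some .emitN) i s (ones j) o)) =
        some (cfg none i s [] (ones j ++ o))
  | 0, o => by rw [iterate_bind_succ]; simpa using step_emitN_nil i s o
  | j + 1, o => by
    rw [iterate_bind_succ, show ones (j + 1) = true :: ones j from rfl, step_emitN_cons,
      iterate_emitN i s j (true :: o)]
    simp [ones]

/-- Number of steps on input `z`. [folklore] -/
def steps (z : List Bool) : ℕ :=
  ((boolUnpair z).1.length + 1) + ((z.length + 1) + (((readRest z).length + 1) + readSteps z))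

/-- Linear running time: `steps z ≤ 2|z| + 4`. [folklore] -/
theorem steps_le (z : List Bool) : steps z ≤ 2 * z.length + 4 := by
  have h := readSteps_add_le z
  unfold steps
  omega

/-- The whole run: output `initFn z = hdr |x| 0 z`, all other stacks empty. [folklore] -/
theorem iterate_steps (z : List Bool) :
    (flip bind machine.step)^[steps z] (some (cfg (some .read) z [] [] [])) =
      some (cfg none [] [] [] (initFn z)) := by
  rw [steps, Function.iterate_add_apply _ ((boolUnpair z).1.length + 1),
    Function.iterate_add_apply _ (z.length + 1),
    Function.iterate_add_apply _ ((readRest z).length + 1), iterate_read, List.append_nil,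
    List.append_nil, iterate_copy, ← List.reverse_append, readPrefix_append_readRest]
  have hlen : ∀ l : List Bool, l.length = l.reverse.length := fun l => by simp
  rw [hlen z, iterate_emit, List.reverse_reverse, iterate_emitN]
  simp [initFn, hdr]

/-- Initial configuration. [folklore] -/
theorem initList_eq (z : List Bool) : initList machine z = cfg (some .read) z [] [] [] := by
  refine TM2.Cfg.mk.injEq _ _ _ _ _ _ |>.mpr ⟨rfl, rfl, ?_⟩
  funext k; cases k
  · exact PairFstTM.initList_stk_self machine z
  · exact PairFstTM.initList_stk_ne machine z (k := Stk.S) (fun h => Stk.noConfusion h)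
  · exact PairFstTM.initList_stk_ne machine z (k := Stk.N) (fun h => Stk.noConfusion h)
  · exact PairFstTM.initList_stk_ne machine z (k := Stk.out) (fun h => Stk.noConfusion h)

/-- Halting configuration. [folklore] -/
theorem haltList_eq (o : List Bool) : haltList machine o = cfg none [] [] [] o := by
  refine TM2.Cfg.mk.injEq _ _ _ _ _ _ |>.mpr ⟨rfl, rfl, ?_⟩
  funext k; cases k
  · exact PairFstTM.haltList_stk_ne machine o (k := Stk.inp) (fun h => Stk.noConfusion h)
  · exact PairFstTM.haltList_stk_ne machine o (k := Stk.S) (fun h => Stk.noConfusion h)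
  · exact PairFstTM.haltList_stk_ne machine o (k := Stk.N) (fun h => Stk.noConfusion h)
  · exact PairFstTM.haltList_stk_self machine o

/-- The bundled initial-header machine. [folklore] -/
def aux : TM2ComputableAux Bool Bool where
  tm := machine
  inputAlphabet := Equiv.refl Bool
  outputAlphabet := Equiv.refl Bool

/-- Running time of the bundled initial-header machine. [folklore] -/
theorem outputsWithin (z : List Bool) : aux.OutputsWithin z (initFn z) (2 * z.length + 4) := by
  refine ⟨⟨⟨steps z, ?_⟩, steps_le z⟩⟩
  change (flip bind machine.step)^[steps z] (some (initList machine (z.map id))) =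
    some (haltList machine ((initFn z).map id))
  rw [List.map_id, List.map_id, initList_eq, haltList_eq]
  exact iterate_steps z

end InitTM

open Polynomial in
/-- **The initial header `z ↦ hdr |x| 0 z` is in `FP`** (time `2n + 4`). [Arora–Barak 2009,
§1.3] [cite: AroraBarakCC2009, §1.3] -/
theorem initFn_mem_FP : initFn ∈ FP :=
  ⟨2 * X + 4, InitTM.aux, fun z => (InitTM.outputsWithin z).mono (by simp)⟩

/-! ### Horner evaluation -/

open Polynomial in
/-- **Horner's rule in `FP`**: for every `p : Polynomial ℕ` there is `H ∈ FP` with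
`H (hdr n 0 z) = hdr n (p n) z` — by `Polynomial.recOnHorner`, composing `mulFn` for `p ↦ p·X`
and `succFn^[a]` for `p ↦ p + C a` (`PolyTimeComputable.comp_holds`). [Arora–Barak 2009, §1.3
("basic arithmetic can be done in polynomial time"), §3.1 (polynomials are time constructible)]
[cite: AroraBarakCC2009, §3.1] -/
theorem exists_hornerFn (p : Polynomial ℕ) :
    ∃ H : List Bool → List Bool, H ∈ FP ∧ ∀ (n : ℕ) (z : List Bool), H (hdr n 0 z) = hdr n (p.eval n) z := by
  refine Polynomial.recOnHorner p ?_ ?_ ?_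
  · exact ⟨id, PolyTimeComputable.id (id : List Bool → List Bool), fun n z => by simp⟩
  · rintro q a - - ⟨H, hH, hspec⟩
    refine ⟨succFn^[a] ∘ H, PolyTimeComputable.comp_holds (iterate_succFn_mem_FP a) hH,
      fun n z => ?_⟩
    simp [hspec, iterate_succFn_hdr]
  · rintro q - ⟨H, hH, hspec⟩
    refine ⟨mulFn ∘ H, PolyTimeComputable.comp_holds mulFn_mem_FP hH, fun n z => ?_⟩
    simp [hspec]

/-- **`z ↦ hdr |x| (p |x|) z` is in `FP`** for every polynomial `p` (Horner function after the
initial header). This is the unary clock/budget used by the truncation transducer of the NP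
normal form. [Arora–Barak 2009, §1.3, §3.1] [cite: AroraBarakCC2009, §3.1] -/
theorem evalHdrFn_mem_FP (p : Polynomial ℕ) : evalHdrFn p ∈ FP := by
  obtain ⟨H, hH, hspec⟩ := exists_hornerFn p
  have h : evalHdrFn p = H ∘ initFn := funext fun z => (hspec _ z).symm
  rw [h]
  exact PolyTimeComputable.comp_holds hH initFn_mem_FP

end Literature.Computability.Complexity
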